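import Mathlib
import Summits.MatrixMultiplication.MatrixMultiplication.Theses.ThinBlockAlpha

/-!
# Sketch — crux-ideate stmt-MatrixMultiplication-10595 (ThinPackings), ideator 2, round 1

First-lemma signatures for the two idea cards (they must elaborate; proofs are NOT claimed here):

* card `log-flat-cyclic-designs`: `LogFlatTPP` (generic-pattern lemma, provable now),
  `LogFlatAnchor` (an exact infinite family of thin STPP designs in CYCLIC hosts, provable now),
  `LogFlatTight` (the conjectural two-leg-tight version) and `LogFlatTight → ThinPackings`.
* card `vandermonde-frame-designs`: `MomentCurveSTPP` (anchor, provable now),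
  `PatternedArcTight` (conjectural) and `PatternedArcTight → ThinPackings`.
-/

open Finset Classical

namespace Summit.MatrixMultiplication.MatrixMultiplication.Cruxes.ThinPackings.Ideator2

open Literature.Computability.AlgebraicComplexity

/-- Card 1, first lemma (provable now): the cubic box-map of a log-flat block is injective as soon
as eight explicit products are `𝔽_p`-linearly independent — i.e. the block
`(log(x+𝔽_p^×), log(x+ξ𝔽_p^×), log(x+ζ𝔽_p^×))` has the triple product property in `Fˣ`. -/
def LogFlatTPP : Prop :=
  ∀ (p : ℕ) [Fact p.Prime] (F : Type) [Field F] [Algebra (ZMod p) F] (x ξ ζ : F),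
    LinearIndependent (ZMod p)
      ![x ^ 3, x ^ 2, ξ * x ^ 2, ζ * x ^ 2, ξ * x, ζ * x, ξ * ζ * x, ξ * ζ] →
    Function.Injective (fun v : Fin 3 → ZMod p =>
      (x + algebraMap (ZMod p) F (v 0)) * (x + ξ * algebraMap (ZMod p) F (v 1)) *
        (x + ζ * algebraMap (ZMod p) F (v 2)))

/-- Card 1, anchor (provable now, NOTES.md §log-flat): for every prime `p ≥ 3` and every middle
size `1 ≤ M ≤ p - 1` there is a finite CYCLIC abelian group carrying an STPP family of at least `p`
blocks of the thin shape `⟨p-1, M, p-1⟩` inside a host of order `< p^8`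
(host `(𝔽_{p^8})ˣ`, blocks `log(y + 𝔽_p^×), log(y + ξ S), log(y + ζ 𝔽_p^×)` for `y` running over
`𝔽_p^×`-coset representatives of `𝔽_{p^2}^× ∖ 𝔽_p^×`, `{1, ξ, ζ, ξζ}` independent over `𝔽_{p^2}`). -/
def LogFlatAnchor : Prop :=
  ∀ p : ℕ, p.Prime → 3 ≤ p → ∀ M : ℕ, 1 ≤ M → M ≤ p - 1 →
    ∃ (H : Type) (_ : AddCommGroup H) (_ : Fintype H), IsAddCyclic H ∧
      ∃ (L : ℕ) (A B C : Fin L → Finset H), IsSTPP A B C ∧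
        (∀ i, (A i).card = p - 1 ∧ (B i).card = M ∧ (C i).card = p - 1) ∧
        p ≤ L ∧ Fintype.card H < p ^ 8

/-- Card 1, the conjectural tight form `C⁺` (log-flat designs reach two-leg tightness): for every
slack `η > 0` there are a prime `p ≥ 3`, a finite field `F` of characteristic `p`, directions
`ξ ζ : F` and an index set `X ⊆ F` such that the log-flat family over `X` (middle box all of
`𝔽_p^×`) is STPP in the cyclic group `Additive Fˣ` and `|Fˣ| ≤ |X| · (p-1)^{2+η}`. -/
def LogFlatTight : Prop :=
  ∀ η : ℝ, 0 < η → ∃ (p : ℕ) (_ : Fact p.Prime) (F : Type) (_ : Field F) (_ : Fintype F)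
    (_ : Algebra (ZMod p) F) (ξ ζ : F) (L : ℕ) (x : Fin L → F),
      3 ≤ p ∧ Function.Injective x ∧
      let leg : F → F → Finset (Additive Fˣ) := fun y d =>
        Finset.univ.filter (fun u : Additive Fˣ =>
          ∃ t : ZMod p, t ≠ 0 ∧ ((Additive.toMul u : Fˣ) : F) = y + d * algebraMap (ZMod p) F t)
      IsSTPP (fun i => leg (x i) 1) (fun i => leg (x i) ξ) (fun i => leg (x i) ζ) ∧
      (∀ i, (leg (x i) 1).card = p - 1 ∧ (leg (x i) ξ).card = p - 1 ∧ (leg (x i) ζ).card = p - 1) ∧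
      (Fintype.card (Additive Fˣ) : ℝ) ≤ L * ((p - 1 : ℕ) : ℝ) ^ (2 + η)

/-- Card 1, transfer stub: the tight log-flat conjecture implies the crux (middle leg has full
size `M = N = p - 1 ≥ N^a` for every `a ≤ 1`; the host is handed over with its instances). -/
def LogFlatTransfer : Prop :=
  LogFlatTight → Summit.MatrixMultiplication.MatrixMultiplication.Theses.ThinBlockAlpha.ThinPackings

/-- Card 2, anchor (provable now): moment-curve (Vandermonde) frame designs. For a finite field
`F` with `|F| ≥ 7` and three pairwise disjoint sets of evaluation points `a, b, c : Fin L → F`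
(injective, disjoint images), the blocks `A_i = F^× · m(a i)`, `B_i = S · m(b i)`,
`C_i = F^× · m(c i)` in `F^6`, `m(τ) = (1, τ, …, τ^5)`, `S ⊆ F^×` arbitrary non-empty, form an
STPP family (any six distinct moment vectors are independent). -/
def MomentCurveSTPP : Prop :=
  ∀ (F : Type) [Field F] [Fintype F] [DecidableEq F] (L : ℕ) (a b c : Fin L → F) (S : Finset F),
    Function.Injective a → Function.Injective b → Function.Injective c →
    (∀ i j, a i ≠ b j) → (∀ i j, b i ≠ c j) → (∀ i j, c i ≠ a j) → (0 : F) ∉ S →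
    let m : F → (Fin 6 → F) := fun τ k => τ ^ (k : ℕ)
    IsSTPP (fun i => (Finset.univ.filter (· ≠ (0 : F))).image (fun t => t • m (a i)))
           (fun i => S.image (fun s => s • m (b i)))
           (fun i => (Finset.univ.filter (· ≠ (0 : F))).image (fun r => r • m (c i)))

/-- Card 2, conjectural tight form: "patterned arcs beyond curves" — for every `η > 0` there are a
finite field `F` (`|F| = Q`), an exponent-witness prime `p = ringChar F`, a dimension `n` and an
injective index map `i ↦ (x i, y i, z i)` into `(F^n)^3` with `L ≥ Q^{n-2-η}`… stated directly in
the crux's currency: an STPP family of Desarguesian thin lines with `|H| ≤ L (Q-1)^{2+η}`. -/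
def PatternedArcTight : Prop :=
  ∀ η : ℝ, 0 < η → ∃ (F : Type) (_ : Field F) (_ : Fintype F) (_ : DecidableEq F) (n L : ℕ)
    (x y z : Fin L → (Fin n → F)) (S : Finset F),
      (0 : F) ∉ S ∧ S.Nonempty ∧
      IsSTPP (fun i => (Finset.univ.filter (· ≠ (0 : F))).image (fun t => t • x i))
             (fun i => S.image (fun s => s • y i))
             (fun i => (Finset.univ.filter (· ≠ (0 : F))).image (fun r => r • z i)) ∧
      (∀ i, ((Finset.univ.filter (· ≠ (0 : F))).image (fun t => t • x i)).card = Fintype.card F - 1 ∧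
            ((Finset.univ.filter (· ≠ (0 : F))).image (fun r => r • z i)).card = Fintype.card F - 1) ∧
      3 ≤ Fintype.card F ∧
      (Fintype.card (Fin n → F) : ℝ) ≤ L * ((Fintype.card F - 1 : ℕ) : ℝ) ^ (2 + η)

/-- Card 2, transfer stub. -/
def PatternedArcTransfer : Prop :=
  PatternedArcTight → Summit.MatrixMultiplication.MatrixMultiplication.Theses.ThinBlockAlpha.ThinPackings

end Summit.MatrixMultiplication.MatrixMultiplication.Cruxes.ThinPackings.Ideator2
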